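import Summits.QuantumFields.YangMills.Theorems.LuscherReductionTwistedTraceScalingBTProductForm
import Summits.QuantumFields.YangMills.Theorems.LuscherReductionTwistedTraceScalingBOTransport
import Summits.QuantumFields.YangMills.Theorems.LuscherReductionTwistedTraceScalingBTCoreWeight
import HarnessLib

/-!
# (C2-moments, step (iv-a)) THE TWO-PROFILE KERNEL: `∫ Ω₁(x̂)·fpFibreTransfer β Ω₂ W (oT u v) u' dπ(v)` is one integral over `V × (V × G)` and is DOMINATED by `fpBOKernel β Ω̃ W u u'`
# for any common majorant `Ω̃ ≥ Ω₁, Ω₂` — the Fubini/monotonicity step that turns the output integration of a reweighted CENTRAL fibre transfer into a REFERENCE-DENSITY mass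
# (memo `Cruxes/NearFlatRatioLaw/Lines/ratepack-v7-moments-g18.md` §5 (A4); route `FlatTubeReduction`, crux K1 `NearFlatRatioLaw` stmt-QuantumFields-24720, line «ratepack_v2» skeleton v6,
# stub `stub_hODpot_A`; seat `ym-line-ftr-p1` g18; R2b1 RECORD rung — no summit statement is proved here)

WHY.  After Cauchy–Schwarz (`…CoreTransferMomentsCS`) the squared core-transfer defect at output `oT u' x'` contains colour-averaged reweighted central transfers
`T[Ω_c·m_v, W·m_g](c⁻¹(oT 1 x')c)`; integrating the output fibre point `x'` against `Ω_c(x')` (what `M(x')·e^{−β²‖P_Γx'‖²}/w` amounts to on the inner core) produces the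
TWO-PROFILE kernel `∫dπ(x') Ω_c(x')·T[Ω_c m_v, W m_g](oT 1 x')`, and `Ω_c, Ω_c m_v ≤ Ω̃ := Ω_c(1 + m_v)` makes it `≤ fpBOKernel β Ω̃ (W m_g) 1 1` — a reference-density mass to which
`…ReferenceMoments` / `…ReweightedProfile` apply.
* §1 `integral_profile_mul_fpFibreTransfer_eq_prod` — Fubini: `∫ Ω₁(x̂)·fpFibreTransfer β Ω₂ W (oT u v) u' dπ(v) = ∫ Ω₁(x̂_v)·(W(g)K(oT u v,(oT u' v')^g)·Ω₂(x̂_{v'})) d(π⊗(π⊗dg))`;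
* §2 ★★ `integral_profile_mul_fpFibreTransfer_le_fpBOKernel` — `≤ fpBOKernel β Ω̃ W u u'` for `0 ≤ Ω₁, Ω₂ ≤ Ω̃`, `W ≥ 0`.
HONEST FRAMING: Fubini bookkeeping for a stub of the CONDITIONAL reduction route R2b1 (rate twin); femto rung R2b1 (RECORD label); not infinite volume, not a mass gap, not Clay.
No defs, no named facts, no `sorry`.
-/

set_option autoImplicit false

noncomputable section

open MeasureTheory Filter Topology Real
open scoped BigOperators
open Literature.MathematicalPhysics.QuantumFieldTheory
open Literature.MathematicalPhysics.QuantumLattice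

namespace Summit.QuantumFields.YangMills.Theorems.FemtoTransferGap.TwoLattice.ConstTube

open Summit.QuantumFields.YangMills.Theorems.FemtoTransferGap
open Summit.QuantumFields.YangMills.Theorems.FemtoTransferGap.TwoLattice
open Summit.QuantumFields.YangMills.Theorems.FemtoTransferGap.TwoLattice.Avg
open Summit.QuantumFields.YangMills.Theorems.FemtoTransferGap.TwoLattice.Stiff (LinkSpace)

variable {L : ℕ} [NeZero L]

/-! ## §1 Fubini for the two-profile kernel -/

/-- The two-profile product integrand is `Ω₁(x̂_v)·fpTriple β 1 W u u' p·Ω₂(x̂_{v'})`; measurable and bounded. [folklore] -/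
theorem twoProfile_integrand_props (β : ℝ) {Ω₁ Ω₂ : LinkSpace L → ℝ} (hΩ₁m : Measurable Ω₁) (hΩ₂m : Measurable Ω₂) {C₁ C₂ : ℝ} (hC₁ : ∀ x, |Ω₁ x| ≤ C₁) (hC₂ : ∀ x, |Ω₂ x| ≤ C₂)
    {W : (Site 3 L → SU2) → ℝ} (hW : Measurable W) {CW : ℝ} (hCW : ∀ g, |W g| ≤ CW) (u u' : GaugeConfig 3 1 SU2) :
    Measurable (fun p : (Edge 3 L → Fin 3 → ℝ) × ((Edge 3 L → Fin 3 → ℝ) × (Site 3 L → SU2)) =>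
        Ω₁ (linkEmbed L p.1) * (W p.2.2 * transferKernel su2Rep β (orthoTube L u p.1) (gaugeTransform p.2.2 (orthoTube L u' p.2.1)) * Ω₂ (linkEmbed L p.2.1))) ∧
      ∃ B : ℝ, ∀ p : (Edge 3 L → Fin 3 → ℝ) × ((Edge 3 L → Fin 3 → ℝ) × (Site 3 L → SU2)),
        |Ω₁ (linkEmbed L p.1) * (W p.2.2 * transferKernel su2Rep β (orthoTube L u p.1) (gaugeTransform p.2.2 (orthoTube L u' p.2.1)) * Ω₂ (linkEmbed L p.2.1))| ≤ B := by
  have hT := measurable_fpTriple β (measurable_const : Measurable fun _ : LinkSpace L => (1 : ℝ)) hW u u'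
  have e : (fun p : (Edge 3 L → Fin 3 → ℝ) × ((Edge 3 L → Fin 3 → ℝ) × (Site 3 L → SU2)) =>
        Ω₁ (linkEmbed L p.1) * (W p.2.2 * transferKernel su2Rep β (orthoTube L u p.1) (gaugeTransform p.2.2 (orthoTube L u' p.2.1)) * Ω₂ (linkEmbed L p.2.1))) =
      fun p => Ω₁ (linkEmbed L p.1) * fpTriple L β (fun _ => (1 : ℝ)) W u u' p * Ω₂ (linkEmbed L p.2.1) := by
    funext p; unfold fpTriple; ring
  refine ⟨?_, ?_⟩
  · rw [e]
    exact ((hΩ₁m.comp ((measurable_linkEmbed L).comp measurable_fst)).mul hT).mul (hΩ₂m.comp ((measurable_linkEmbed L).comp (measurable_fst.comp measurable_snd)))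
  · obtain ⟨M, hM⟩ := exists_transferKernel_le su2Rep continuous_su2Rep β (L := L)
    have hC₁0 : 0 ≤ C₁ := (abs_nonneg _).trans (hC₁ 0)
    have hC₂0 : 0 ≤ C₂ := (abs_nonneg _).trans (hC₂ 0)
    have hCW0 : 0 ≤ CW := (abs_nonneg _).trans (hCW 1)
    have hM0 : 0 ≤ M := (transferKernel_pos su2Rep β (1 : GaugeConfig 3 L SU2) 1).le.trans (hM 1 1)
    refine ⟨C₁ * (CW * M * C₂), fun p => ?_⟩
    rw [abs_mul, abs_mul, abs_mul, abs_of_pos (transferKernel_pos su2Rep β _ _)]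
    exact mul_le_mul (hC₁ _) (mul_le_mul (mul_le_mul (hCW _) (hM _ _) (transferKernel_pos su2Rep β _ _).le hCW0) (hC₂ _) (abs_nonneg _) (mul_nonneg hCW0 hM0))
      (mul_nonneg (mul_nonneg (abs_nonneg _) (transferKernel_pos su2Rep β _ _).le) (abs_nonneg _)) hC₁0

/-- ★ **Fubini for the two-profile kernel**: `∫ Ω₁(x̂_v)·fpFibreTransfer β Ω₂ W (oT u v) u' dπ(v) = ∫ Ω₁(x̂_v)·(W(g)·K_β(oT u v,(oT u' v')^g)·Ω₂(x̂_{v'})) d(π ⊗ (π ⊗ dg))`. [folklore] -/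
theorem integral_profile_mul_fpFibreTransfer_eq_prod (β : ℝ) {Ω₁ Ω₂ : LinkSpace L → ℝ} (hΩ₁m : Measurable Ω₁) (hΩ₂m : Measurable Ω₂) {C₁ C₂ : ℝ} (hC₁ : ∀ x, |Ω₁ x| ≤ C₁)
    (hC₂ : ∀ x, |Ω₂ x| ≤ C₂) {W : (Site 3 L → SU2) → ℝ} (hW : Measurable W) {CW : ℝ} (hCW : ∀ g, |W g| ≤ CW) (u u' : GaugeConfig 3 1 SU2) :
    ∫ v, Ω₁ (linkEmbed L v) * fpFibreTransfer L β Ω₂ W (orthoTube L u v) u' ∂orthoTransverse L =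
      ∫ p, Ω₁ (linkEmbed L p.1) * (W p.2.2 * transferKernel su2Rep β (orthoTube L u p.1) (gaugeTransform p.2.2 (orthoTube L u' p.2.1)) * Ω₂ (linkEmbed L p.2.1))
        ∂((orthoTransverse L).prod ((orthoTransverse L).prod (gaugeMeasure L))) := by
  haveI := isFiniteMeasure_orthoTransverse L
  obtain ⟨hm, B, hB⟩ := twoProfile_integrand_props β hΩ₁m hΩ₂m hC₁ hC₂ hW hCW u u'
  have hint : Integrable (fun p : (Edge 3 L → Fin 3 → ℝ) × ((Edge 3 L → Fin 3 → ℝ) × (Site 3 L → SU2)) =>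
      Ω₁ (linkEmbed L p.1) * (W p.2.2 * transferKernel su2Rep β (orthoTube L u p.1) (gaugeTransform p.2.2 (orthoTube L u' p.2.1)) * Ω₂ (linkEmbed L p.2.1)))
      ((orthoTransverse L).prod ((orthoTransverse L).prod (gaugeMeasure L))) := integrable_of_measurable_abs_le _ hm hB
  rw [integral_prod _ hint]
  refine integral_congr_ae (ae_of_all _ fun v => ?_)
  dsimp only
  unfold fpFibreTransfer
  rw [← integral_const_mul]

/-! ## §2 ★★ Domination by a one-profile `fpBOKernel` -/

/-- ★★ **TWO-PROFILE DOMINATION**: for `0 ≤ Ω₁ ≤ Ω̃`, `0 ≤ Ω₂ ≤ Ω̃` (all bounded measurable) and `W ≥ 0` bounded measurable,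
`∫ Ω₁(x̂_v)·fpFibreTransfer β Ω₂ W (oT u v) u' dπ(v) ≤ fpBOKernel β Ω̃ W u u'`. [folklore] -/
theorem integral_profile_mul_fpFibreTransfer_le_fpBOKernel (β : ℝ) {Ω₁ Ω₂ Ωt : LinkSpace L → ℝ} (hΩ₁m : Measurable Ω₁) (hΩ₂m : Measurable Ω₂) (hΩtm : Measurable Ωt)
    {C₁ C₂ Ct : ℝ} (hC₁ : ∀ x, |Ω₁ x| ≤ C₁) (hC₂ : ∀ x, |Ω₂ x| ≤ C₂) (hCt : ∀ x, |Ωt x| ≤ Ct) (hΩ₁0 : ∀ x, 0 ≤ Ω₁ x) (hΩ₂0 : ∀ x, 0 ≤ Ω₂ x)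
    (h₁ : ∀ x, Ω₁ x ≤ Ωt x) (h₂ : ∀ x, Ω₂ x ≤ Ωt x)
    {W : (Site 3 L → SU2) → ℝ} (hW : Measurable W) {CW : ℝ} (hCW : ∀ g, |W g| ≤ CW) (hW0 : ∀ g, 0 ≤ W g) (u u' : GaugeConfig 3 1 SU2) :
    ∫ v, Ω₁ (linkEmbed L v) * fpFibreTransfer L β Ω₂ W (orthoTube L u v) u' ∂orthoTransverse L ≤ fpBOKernel L β Ωt W u u' := by
  haveI := isFiniteMeasure_orthoTransverse L
  rw [integral_profile_mul_fpFibreTransfer_eq_prod β hΩ₁m hΩ₂m hC₁ hC₂ hW hCW u u', fpBOKernel_eq_integral_prod β hΩtm hCt hW hCW u u']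
  obtain ⟨hm, B, hB⟩ := twoProfile_integrand_props β hΩ₁m hΩ₂m hC₁ hC₂ hW hCW u u'
  obtain ⟨Bt, hBt⟩ := abs_fpTriple_le (L := L) β hCt hCW u u'
  refine integral_mono (integrable_of_measurable_abs_le _ hm hB) (integrable_of_measurable_abs_le _ (measurable_fpTriple β hΩtm hW u u') hBt) fun p => ?_
  unfold fpTriple
  have hK : 0 ≤ W p.2.2 * transferKernel su2Rep β (orthoTube L u p.1) (gaugeTransform p.2.2 (orthoTube L u' p.2.1)) :=
    mul_nonneg (hW0 _) (transferKernel_pos su2Rep β _ _).le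
  have hΩt0 : 0 ≤ Ωt (linkEmbed L p.1) := (hΩ₁0 _).trans (h₁ _)
  calc Ω₁ (linkEmbed L p.1) * (W p.2.2 * transferKernel su2Rep β (orthoTube L u p.1) (gaugeTransform p.2.2 (orthoTube L u' p.2.1)) * Ω₂ (linkEmbed L p.2.1))
      ≤ Ωt (linkEmbed L p.1) * (W p.2.2 * transferKernel su2Rep β (orthoTube L u p.1) (gaugeTransform p.2.2 (orthoTube L u' p.2.1)) * Ω₂ (linkEmbed L p.2.1)) :=
        mul_le_mul_of_nonneg_right (h₁ _) (mul_nonneg hK (hΩ₂0 _))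
    _ ≤ Ωt (linkEmbed L p.1) * (W p.2.2 * transferKernel su2Rep β (orthoTube L u p.1) (gaugeTransform p.2.2 (orthoTube L u' p.2.1)) * Ωt (linkEmbed L p.2.1)) :=
        mul_le_mul_of_nonneg_left (mul_le_mul_of_nonneg_left (h₂ _) hK) hΩt0

end Summit.QuantumFields.YangMills.Theorems.FemtoTransferGap.TwoLattice.ConstTube

end
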